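import Mathlib
import HarnessLib
import Literature.Analysis.FluidPDE.ClassicalSolutionRegion
import Literature.Analysis.FluidPDE.SpaceTimeCalculus
import Summits.NavierStokesRegularity.NavierStokesRegularity.Theorems.PoloidalWindowDoorPoloidalWindowRigidityWindow
import Summits.NavierStokesRegularity.NavierStokesRegularity.Theorems.AdaptedFrequencyTangentFlowTransferAncientPressure
import Summits.NavierStokesRegularity.NavierStokesRegularity.Theorems.PoloidalWindowDoorPoloidalWindowRigidityK2OfLrcSlope
import Summits.NavierStokesRegularity.NavierStokesRegularity.Theorems.PoloidalWindowDoorPoloidalWindowRigidityFirstIntegral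

/-!
# Route `PoloidalWindowDoor`, crux `PoloidalWindowRigidity` (K2, stmt-NavierStokesRegularity-19708) — the registered stub
# `stub_hyperbolicThick` of `Cruxes/PoloidalWindowRigidity/Lines/mixed_type.lean` (v1), VERBATIM, from the POINTWISE-PINNED
# local statement «no hyperbolic twisting poloidal NS germ with non-zero horizontal slope gradient»

Cell ns-regularity-ideate, seat ns-poloidal-K2-p4 gen 0 (stub-worker on `mixed_type::stub_hyperbolicThick`, the (R-THICK)
residue of `Cruxes/PoloidalWindowRigidity/Disproof.lean::stubTwisting_iff_residues` in the hyperbolic type; lead of record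
ns-poloidal-K2-p2; file landed `--supports stmt-NavierStokesRegularity-19708` as a helper; companion of
`…PoloidalWindowDoorPoloidalWindowRigidityHyperbolicThickOfLocal` (same seat), which closes the stub modulo the S2-shaped local
statement «every twisting ND hyperbolic poloidal analytic NS germ is time–height on SOME open subset»).

THE POINT OF THIS FILE.  «Time–height on NO open subset» (THICK) is not a condition on any jet, so no finite-order / differential-
elimination certificate (cert-1, nsreg-p7) can consume it.  Here the thick clause is converted, inside the class, into an OPEN
POINTWISE condition: with the shear RATIO `Λ := ⟪∂₂vₕ, ∇ₕv₂⟫ / |∇ₕv₂|²` (the scalar with `∂₂v_b = Λ ∂_b v₂`, `b = 0,1`, on a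
frozen non-degenerate window — `eq_ratio_mul_of_frozen`), a thick window contains a nonempty OPEN sub-window on which
`∇ₕΛ ≠ 0` (else `∇ₕΛ ≡ 0` on the window, and on a ball `Λ` is a function of `(t, y₂)` by horizontal constancy —
`eq_of_horizontal_fderiv_eq_zero` — i.e. the ball is time–height, contradicting thickness).  Hence:

* `stub_hyperbolicThick_of_localHypThickOpen` — `stub_hyperbolicThick` VERBATIM from the local statement `hopen`: «there is no
  real-analytic classical NS pair `(u, q)` on a nonempty open space–time set `U` which at EVERY point of `U` is poloidal along
  `e₃`, FROZEN (`∂₂u₀·∂₁u₂ = ∂₂u₁·∂₀u₂`, i.e. `ω·∇u₂ = 0`), non-degenerate, twisting, hyperbolic (`⟪∂₂uₕ, ∇ₕu₂⟫ < 0`) and has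
  `∇ₕΛ ≠ 0` (`∂₀Λ ≠ 0 ∨ ∂₁Λ ≠ 0`, `Λ` the ratio above written out in the 1-jet of `u`)» — a statement about an OPEN condition on
  jets of a local analytic NS germ, i.e. exactly the shape the cell's engines decide («compatibility of the poloidal NS system with
  a generic jet at one point, to all orders»).  The frozen clause is supplied from the class by the tree theorem
  `…FirstIntegral.stub_firstIntegral` (the `e₃`-component of the vorticity equation), so `hopen` may assume it.

Honest remarks.  (i) `∇ₕΛ ≠ 0` is the jet form of THICK only up to the leafwise identity `∇ₕΛ ∥ ∇ₕu₂` (curlₕ of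
`∂₂uₕ = Λ∇ₕu₂` with `curlₕ uₕ = 0`), under which `∇ₕΛ ≠ 0 ⇔ ∂_wΛ = ⟪∇ₕΛ, ∇ₕu₂⟫/|∇ₕu₂|² ≠ 0 ⇔ G_uu ≠ 0` for the structure
function `∂₂φ = G(t, y₂, u₂)`; the reduction does not need it.  (ii) Kinematic thick twisting hyperbolic germs exist locally
(Cauchy–Kovalevskaya for `u_zz + Δₕ[G(u,z)] = 0`, refuter1 K-48), so the momentum clause of `hopen` is load-bearing, as (M) is for
the stub (`…Negative.*FalseWithoutMild`).  (iii) `hopen` is refuted by ONE explicit germ; such a germ kills the LOCAL lines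
(`local_rigidity` S2) but not by itself the class-level stub.

WHAT THIS IS NOT: not a proof of `stub_hyperbolicThick`, of the crux, or of anything about Navier–Stokes regularity (Clay (A)
untouched) — a kernel-checked conversion of the THICK ∩ hyperbolic class residue into ONE pointwise-open local emptiness
statement.  bears_on LADDER-NS N0, crux 19708 (line mixed_type, stub `stub_hyperbolicThick`).
-/

noncomputable section

-- the summit and its single sub-problem share the name (CONVENTIONS §1), as in every Theorems file
set_option linter.dupNamespace false

namespace Summit.NavierStokesRegularity.NavierStokesRegularity.Theorems.PoloidalWindowDoorPoloidalWindowRigidityHyperbolicThickOfLocalOpen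

open Set Function Metric Filter
open scoped RealInnerProductSpace InnerProductSpace Topology
open Literature.Analysis Literature.Analysis.FluidPDE
open Summit.NavierStokesRegularity.NavierStokesRegularity.Theorems
open Summit.NavierStokesRegularity.NavierStokesRegularity.Theorems.PoloidalWindowDoorPoloidalWindowRigidityWindow
open Summit.NavierStokesRegularity.NavierStokesRegularity.Theorems.LocalSineTubeDoorProfileAlignedWindowRigidityAncient
open Summit.NavierStokesRegularity.NavierStokesRegularity.Theorems.TubeAlternative.AnalyticPropagation
open Summit.NavierStokesRegularity.NavierStokesRegularity.Theorems.PoloidalWindowDoorPoloidalWindowRigidityK2OfLrcSlope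
open Summit.NavierStokesRegularity.NavierStokesRegularity.Theorems.PoloidalWindowDoorPoloidalWindowRigidityFirstIntegral

/-! ### Toolkit: linear algebra on `ℝ³`, horizontal constancy, ball sections -/

/-- Pointwise: the frozen relation `a₀ g₁ = a₁ g₀` with `(g₀, g₁) ≠ 0` makes `(a₀, a₁)` proportional to `(g₀, g₁)` with the
RATIO `(a₀g₀ + a₁g₁)/(g₀² + g₁²)`. -/
theorem eq_ratio_mul_of_frozen {a₀ a₁ g₀ g₁ : ℝ} (hfr : a₀ * g₁ = a₁ * g₀) (hg : g₀ ≠ 0 ∨ g₁ ≠ 0) :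
    a₀ = (a₀ * g₀ + a₁ * g₁) / (g₀ ^ 2 + g₁ ^ 2) * g₀ ∧
      a₁ = (a₀ * g₀ + a₁ * g₁) / (g₀ ^ 2 + g₁ ^ 2) * g₁ := by
  have hne : g₀ ^ 2 + g₁ ^ 2 ≠ 0 := by
    rcases hg with h | h
    · have h' : 0 < g₀ ^ 2 := by positivity
      have := sq_nonneg g₁
      exact ne_of_gt (by linarith)
    · have h' : 0 < g₁ ^ 2 := by positivity
      have := sq_nonneg g₀
      exact ne_of_gt (by linarith)
  constructor
  · rw [div_mul_eq_mul_div, eq_div_iff hne]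
    linear_combination g₁ * hfr
  · rw [div_mul_eq_mul_div, eq_div_iff hne]
    linear_combination (-g₀) * hfr

/-- Expansion of a continuous linear map on `ℝ³` along the standard basis. [folklore] -/
theorem clm_apply_eq_sum_three {G : Type*} [NormedAddCommGroup G] [NormedSpace ℝ G]
    (L : EuclideanSpace ℝ (Fin 3) →L[ℝ] G) (d : EuclideanSpace ℝ (Fin 3)) :
    L d = d 0 • L (EuclideanSpace.single 0 1) + d 1 • L (EuclideanSpace.single 1 1) +
      d 2 • L (EuclideanSpace.single 2 1) := by
  have hd : d = d 0 • EuclideanSpace.single 0 (1 : ℝ) + d 1 • EuclideanSpace.single 1 (1 : ℝ) +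
      d 2 • EuclideanSpace.single 2 (1 : ℝ) := by
    ext i
    fin_cases i <;> simp
  conv_lhs => rw [hd]
  simp only [map_add, map_smul]

/-- **Horizontal constancy.**  A function on `ℝ³`, differentiable at the points of a convex set `S` with vanishing horizontal
partial derivatives there, takes equal values at two points of `S` of the same height (mean value along the horizontal segment).
[folklore] -/
theorem eq_of_horizontal_fderiv_eq_zero {F : EuclideanSpace ℝ (Fin 3) → ℝ} {S : Set (EuclideanSpace ℝ (Fin 3))}
    (hS : Convex ℝ S) (hF : ∀ y ∈ S, DifferentiableAt ℝ F y)
    (h0 : ∀ y ∈ S, fderiv ℝ F y (EuclideanSpace.single 0 1) = 0)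
    (h1 : ∀ y ∈ S, fderiv ℝ F y (EuclideanSpace.single 1 1) = 0)
    {y y' : EuclideanSpace ℝ (Fin 3)} (hy : y ∈ S) (hy' : y' ∈ S) (h2 : y 2 = y' 2) : F y = F y' := by
  set d : EuclideanSpace ℝ (Fin 3) := y - y' with hd
  have hd2 : d 2 = 0 := by simp [hd, h2]
  set γ : ℝ → EuclideanSpace ℝ (Fin 3) := fun s => y' + s • d with hγ
  have hγS : ∀ s ∈ Icc (0 : ℝ) 1, γ s ∈ S := by
    intro s hs
    have e : γ s = (1 - s) • y' + s • y := by
      simp only [hγ, hd, smul_sub, sub_smul, one_smul]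
      abel
    rw [e]
    exact hS hy' hy (by linarith [hs.2]) hs.1 (by ring)
  have hderiv : ∀ s ∈ Icc (0 : ℝ) 1, HasDerivAt (F ∘ γ) 0 s := by
    intro s hs
    have hγ' : HasDerivAt γ d s := by
      have h := ((hasDerivAt_id s).smul_const d).const_add y'
      simpa [hγ] using h
    have hcomp := (hF _ (hγS s hs)).hasFDerivAt.comp_hasDerivAt s hγ'
    have hval : fderiv ℝ F (γ s) d = 0 := by
      rw [clm_apply_eq_sum_three, h0 _ (hγS s hs), h1 _ (hγS s hs), hd2]
      simp
    rw [hval] at hcomp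
    exact hcomp
  have hconst := constant_of_has_deriv_right_zero (f := F ∘ γ) (a := 0) (b := 1)
    (fun s hs => (hderiv s hs).continuousAt.continuousWithinAt)
    (fun s hs => (hderiv s ⟨hs.1, hs.2.le⟩).hasDerivWithinAt)
  have h10 := hconst 1 ⟨zero_le_one, le_rfl⟩
  simpa [hγ, hd] using h10

/-- The height-section `{y | (t, y) ∈ B}` of a ball of `ℝ × ℝ³` is convex. [folklore] -/
theorem convex_section_ball (z₀ : ℝ × EuclideanSpace ℝ (Fin 3)) (r t : ℝ) :
    Convex ℝ {y : EuclideanSpace ℝ (Fin 3) | (t, y) ∈ ball z₀ r} := by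
  intro y₁ hy₁ y₂ hy₂ a b ha hb hab
  have h := convex_ball z₀ r hy₁ hy₂ ha hb hab
  have e : a • ((t, y₁) : ℝ × EuclideanSpace ℝ (Fin 3)) + b • (t, y₂) = (t, a • y₁ + b • y₂) := by
    ext <;> simp [← add_mul, hab]
  rw [e] at h
  exact h

/-- Sliding a point of a ball of `ℝ × ℝ³` horizontally onto the vertical line through the centre keeps it in the ball. [folklore] -/
theorem mem_ball_of_sameHeight {z₀ : ℝ × EuclideanSpace ℝ (Fin 3)} {r : ℝ} {p : ℝ × EuclideanSpace ℝ (Fin 3)}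
    (hp : p ∈ ball z₀ r) :
    (p.1, z₀.2 + (p.2 2 - z₀.2 2) • EuclideanSpace.single 2 (1 : ℝ)) ∈ ball z₀ r := by
  rw [mem_ball, Prod.dist_eq] at hp ⊢
  refine max_lt (lt_of_le_of_lt (le_max_left _ _) hp) (lt_of_le_of_lt ?_ (lt_of_le_of_lt (le_max_right _ _) hp))
  rw [dist_eq_norm, dist_eq_norm, add_sub_cancel_left, norm_smul]
  have hs : ‖(EuclideanSpace.single 2 (1 : ℝ) : EuclideanSpace ℝ (Fin 3))‖ = 1 := by simp
  rw [hs, mul_one]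
  calc ‖p.2 2 - z₀.2 2‖ = |(p.2 - z₀.2) 2| := by simp
    _ ≤ ‖p.2 - z₀.2‖ := by
        have := abs_real_inner_le_norm (p.2 - z₀.2) (EuclideanSpace.single 2 (1 : ℝ))
        simpa [EuclideanSpace.inner_single_right] using this

/-! ### Toolkit: pointwise joint analyticity of slice derivatives -/

section SliceDeriv

variable {X : Type*} [NormedAddCommGroup X] [NormedSpace ℝ X]
variable {F : Type*} [NormedAddCommGroup F] [NormedSpace ℝ F] [CompleteSpace F]

/-- Pointwise form of `…AnalyticPropagation.analyticOnNhd_uncurry_fderiv_slice`: if `uncurry w` is analytic at `z`, the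
slice-derivative field `(t,x) ↦ D(w t)(x)` is analytic at `z`. [folklore] -/
theorem analyticAt_uncurry_fderiv_slice {w : ℝ → X → F} {z : ℝ × X} (hw : AnalyticAt ℝ (uncurry w) z) :
    AnalyticAt ℝ (uncurry fun t x => fderiv ℝ (w t) x) z := by
  have hc : AnalyticAt ℝ (fun z => (fderiv ℝ (uncurry w) z).comp (ContinuousLinearMap.inr ℝ ℝ X)) z :=
    analyticAt_clm_comp_const_of_analyticAt _ hw.fderiv
  refine hc.congr ?_
  filter_upwards [hw.eventually_analyticAt] with z' hz'
  rcases z' with ⟨t, x⟩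
  exact ((hasFDerivAt_slice hz'.differentiableAt.hasFDerivAt).fderiv).symm

/-- Pointwise: `(t,x) ↦ D(w t)(x)[e]` is analytic at `z` for a fixed vector `e`. [folklore] -/
theorem analyticAt_uncurry_fderiv_slice_apply {w : ℝ → X → F} {z : ℝ × X} (hw : AnalyticAt ℝ (uncurry w) z)
    (e : X) : AnalyticAt ℝ (uncurry fun t x => fderiv ℝ (w t) x e) z := by
  have h := analyticAt_uncurry_fderiv_slice hw
  have e1 : (uncurry fun t x => fderiv ℝ (w t) x e) =
      (fun L : X →L[ℝ] F => L e) ∘ (uncurry fun t x => fderiv ℝ (w t) x) := by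
    funext p; rfl
  rw [e1]
  exact ((ContinuousLinearMap.apply ℝ F e).analyticAt _).comp h

omit [CompleteSpace F] in
/-- Slices of a field jointly analytic at `(t, x)` are analytic at `x`. [folklore] -/
theorem analyticAt_slice {w : ℝ → X → F} {t : ℝ} {x : X} (hw : AnalyticAt ℝ (uncurry w) (t, x)) :
    AnalyticAt ℝ (w t) x :=
  hw.comp (analyticAt_const.prod analyticAt_id)

end SliceDeriv

/-! ### The frozen identity of a poloidal class profile, in coordinates -/

variable {C : ℝ} {v : ℝ → EuclideanSpace ℝ (Fin 3) → EuclideanSpace ℝ (Fin 3)}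

/-- FROZEN in coordinates for a poloidal class profile: `∂₂v₀·∂₁v₂ = ∂₂v₁·∂₀v₂` — the `e₃`-component `⟪Dv·ω, e₃⟫ = 0` of the
vortex stretching (tree `…FirstIntegral.stub_firstIntegral`) expanded with `ω₂ = 0`, `ω₀ = ∂₁v₂ − ∂₂v₁`, `ω₁ = ∂₂v₀ − ∂₀v₂`. -/
theorem frozen_coord (hrate : HasTypeITimeDecay C v)
    (hcont : ContinuousOn (uncurry v) (Iio (0 : ℝ) ×ˢ univ))
    (hmild : ∀ s t : ℝ, s < t → t < 0 → ∀ x,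
      v t x = UnboundedOperators.heatExtension (v s) (t - s) x - oseenDuhamel 1 s v v t x)
    (hdiv : ∀ t < 0, VectorCalculus.IsDivFree (v t))
    (hpol : ∀ s < 0, ∀ y, ⟪curl (v s) y, EuclideanSpace.single 2 1⟫_ℝ = 0) {s : ℝ} (hs : s < 0)
    (y : EuclideanSpace ℝ (Fin 3)) :
    fderiv ℝ (v s) y (EuclideanSpace.single 2 1) 0 * fderiv ℝ (v s) y (EuclideanSpace.single 1 1) 2 =
      fderiv ℝ (v s) y (EuclideanSpace.single 2 1) 1 * fderiv ℝ (v s) y (EuclideanSpace.single 0 1) 2 := by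
  have h := stub_firstIntegral C v hrate hcont hmild hdiv (EuclideanSpace.single 2 1) hpol s hs y
  have hc2 : curl (v s) y 2 = 0 := by
    have := hpol s hs y
    simpa [EuclideanSpace.inner_single_right] using this
  have h' : fderiv ℝ (v s) y (curl (v s) y) 2 = 0 := by
    simpa [EuclideanSpace.inner_single_right] using h
  rw [clm_apply_eq_sum_three (fderiv ℝ (v s) y) (curl (v s) y), hc2, curl_apply_zero_eq, curl_apply_one_eq] at h'
  simp only [zero_smul, add_zero, PiLp.add_apply, PiLp.smul_apply, smul_eq_mul] at h'
  linear_combination h'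

/-! ### The reduction -/

/-- **`stub_hyperbolicThick` (line `mixed_type` v1) VERBATIM, from the pointwise-open local statement `hopen`** («no real-
analytic classical NS germ on a nonempty open set is everywhere poloidal, frozen, non-degenerate, twisting, hyperbolic with
`∇ₕΛ ≠ 0`», `Λ = ⟪∂₂uₕ, ∇ₕu₂⟫/|∇ₕu₂|²` written out).  Proof: the class profile is a jointly analytic classical solution on the
window with a pressure (tree) and frozen (tree); the ratio `Λ` is jointly analytic on the window, so `{∇ₕΛ ≠ 0}` is open there;
if it is nonempty, `hopen` applies to it; if it is empty, `Λ` is horizontally constant on a ball of the window, which is then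
time–height with `m(t,z) := Λ(t, y₀ + (z − y₀₂)e₃)` — contradicting the stub's thick clause. -/
theorem stub_hyperbolicThick_of_localHypThickOpen
    (hopen : ∀ (u : ℝ → EuclideanSpace ℝ (Fin 3) → EuclideanSpace ℝ (Fin 3)) (q : ℝ → EuclideanSpace ℝ (Fin 3) → ℝ)
        (U : Set (ℝ × EuclideanSpace ℝ (Fin 3))),
        IsOpen U → U.Nonempty →
        Literature.Analysis.FluidPDE.IsClassicalNSSolutionOnRegion U 1 0 u q →
        AnalyticOnNhd ℝ (Function.uncurry u) U →
        (∀ p ∈ U, ⟪Literature.Analysis.FluidPDE.curl (u p.1) p.2, EuclideanSpace.single 2 1⟫_ℝ = 0) →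
        (∀ p ∈ U, fderiv ℝ (u p.1) p.2 (EuclideanSpace.single 2 1) 0 * fderiv ℝ (u p.1) p.2 (EuclideanSpace.single 1 1) 2 =
          fderiv ℝ (u p.1) p.2 (EuclideanSpace.single 2 1) 1 * fderiv ℝ (u p.1) p.2 (EuclideanSpace.single 0 1) 2) →
        (∀ p ∈ U, Literature.Analysis.FluidPDE.curl (u p.1) p.2 ≠ 0 ∧
          (fderiv ℝ (u p.1) p.2 (EuclideanSpace.single 0 1) 2 ≠ 0 ∨ fderiv ℝ (u p.1) p.2 (EuclideanSpace.single 1 1) 2 ≠ 0) ∧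
          (fderiv ℝ (u p.1) p.2 (EuclideanSpace.single 2 1) 0 ≠ 0 ∨ fderiv ℝ (u p.1) p.2 (EuclideanSpace.single 2 1) 1 ≠ 0)) →
        (∀ p ∈ U,
          fderiv ℝ (fun y => fderiv ℝ (u p.1) y (EuclideanSpace.single 2 1) 2) p.2 (EuclideanSpace.single 0 1) *
              fderiv ℝ (u p.1) p.2 (EuclideanSpace.single 1 1) 2 -
            fderiv ℝ (fun y => fderiv ℝ (u p.1) y (EuclideanSpace.single 2 1) 2) p.2 (EuclideanSpace.single 1 1) *
              fderiv ℝ (u p.1) p.2 (EuclideanSpace.single 0 1) 2 ≠ 0) →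
        (∀ p ∈ U,
          fderiv ℝ (u p.1) p.2 (EuclideanSpace.single 2 1) 0 * fderiv ℝ (u p.1) p.2 (EuclideanSpace.single 0 1) 2 +
            fderiv ℝ (u p.1) p.2 (EuclideanSpace.single 2 1) 1 * fderiv ℝ (u p.1) p.2 (EuclideanSpace.single 1 1) 2 < 0) →
        (∀ p ∈ U,
          fderiv ℝ (fun y => (fderiv ℝ (u p.1) y (EuclideanSpace.single 2 1) 0 * fderiv ℝ (u p.1) y (EuclideanSpace.single 0 1) 2 +
              fderiv ℝ (u p.1) y (EuclideanSpace.single 2 1) 1 * fderiv ℝ (u p.1) y (EuclideanSpace.single 1 1) 2) /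
            (fderiv ℝ (u p.1) y (EuclideanSpace.single 0 1) 2 ^ 2 + fderiv ℝ (u p.1) y (EuclideanSpace.single 1 1) 2 ^ 2)) p.2 (EuclideanSpace.single 0 1) ≠ 0 ∨
          fderiv ℝ (fun y => (fderiv ℝ (u p.1) y (EuclideanSpace.single 2 1) 0 * fderiv ℝ (u p.1) y (EuclideanSpace.single 0 1) 2 +
              fderiv ℝ (u p.1) y (EuclideanSpace.single 2 1) 1 * fderiv ℝ (u p.1) y (EuclideanSpace.single 1 1) 2) /
            (fderiv ℝ (u p.1) y (EuclideanSpace.single 0 1) 2 ^ 2 + fderiv ℝ (u p.1) y (EuclideanSpace.single 1 1) 2 ^ 2)) p.2 (EuclideanSpace.single 1 1) ≠ 0) →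
        False) :
    ∀ (C : ℝ) (v : ℝ → EuclideanSpace ℝ (Fin 3) → EuclideanSpace ℝ (Fin 3)),
      Literature.Analysis.FluidPDE.HasTypeITimeDecay C v →
      ContinuousOn (Function.uncurry v) (Set.Iio (0 : ℝ) ×ˢ Set.univ) →
      (∀ s t : ℝ, s < t → t < 0 → ∀ x, v t x =
        Literature.Analysis.UnboundedOperators.heatExtension (v s) (t - s) x -
          Literature.Analysis.FluidPDE.oseenDuhamel 1 s v v t x) →
      (∀ t < 0, Literature.Analysis.FluidPDE.VectorCalculus.IsDivFree (v t)) →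
      (∀ s < 0, ∀ y, ⟪Literature.Analysis.FluidPDE.curl (v s) y, EuclideanSpace.single 2 1⟫_ℝ = 0) →
      ∀ W : Set (ℝ × EuclideanSpace ℝ (Fin 3)), IsOpen W → W.Nonempty → W ⊆ Set.Iio (0 : ℝ) ×ˢ Set.univ →
        (∀ z ∈ W, Literature.Analysis.FluidPDE.curl (v z.1) z.2 ≠ 0 ∧
          (fderiv ℝ (v z.1) z.2 (EuclideanSpace.single 0 1) 2 ≠ 0 ∨ fderiv ℝ (v z.1) z.2 (EuclideanSpace.single 1 1) 2 ≠ 0) ∧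
          (fderiv ℝ (v z.1) z.2 (EuclideanSpace.single 2 1) 0 ≠ 0 ∨ fderiv ℝ (v z.1) z.2 (EuclideanSpace.single 2 1) 1 ≠ 0)) →
        (∀ m : ℝ → ℝ, ∀ W₁ : Set (ℝ × EuclideanSpace ℝ (Fin 3)), W₁ ⊆ W → IsOpen W₁ → W₁.Nonempty →
          ∃ z ∈ W₁, ∃ b : Fin 3, b ≠ 2 ∧
            fderiv ℝ (v z.1) z.2 (EuclideanSpace.single 2 1) b ≠
              m z.1 * fderiv ℝ (v z.1) z.2 (EuclideanSpace.single b 1) 2) →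
        (∀ z ∈ W,
          fderiv ℝ (fun x => fderiv ℝ (v z.1) x (EuclideanSpace.single 2 1) 2) z.2 (EuclideanSpace.single 0 1) *
              fderiv ℝ (v z.1) z.2 (EuclideanSpace.single 1 1) 2 -
            fderiv ℝ (fun x => fderiv ℝ (v z.1) x (EuclideanSpace.single 2 1) 2) z.2 (EuclideanSpace.single 1 1) *
              fderiv ℝ (v z.1) z.2 (EuclideanSpace.single 0 1) 2 ≠ 0) →
        (∀ z ∈ W,
          fderiv ℝ (v z.1) z.2 (EuclideanSpace.single 2 1) 0 * fderiv ℝ (v z.1) z.2 (EuclideanSpace.single 0 1) 2 +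
            fderiv ℝ (v z.1) z.2 (EuclideanSpace.single 2 1) 1 * fderiv ℝ (v z.1) z.2 (EuclideanSpace.single 1 1) 2 < 0) →
        (∀ m : ℝ → ℝ → ℝ, ∀ W₁ : Set (ℝ × EuclideanSpace ℝ (Fin 3)), W₁ ⊆ W → IsOpen W₁ → W₁.Nonempty →
          ∃ z ∈ W₁, ∃ b : Fin 3, b ≠ 2 ∧
            fderiv ℝ (v z.1) z.2 (EuclideanSpace.single 2 1) b ≠
              m z.1 (z.2 2) * fderiv ℝ (v z.1) z.2 (EuclideanSpace.single b 1) 2) →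
        ¬ Literature.Analysis.FluidPDE.IsBackwardSingularPoint v 0 := by
  intro C v hrate hcont hmild hdiv hpol W hW hWne hWs hnd _hpin htw hhyp hthick
  -- ## the class profile: classical with a pressure on the window, jointly analytic, frozen
  obtain ⟨q, hq⟩ := exists_isClassicalNSSolutionOn_Iio_of_isTypeIAncientMild (isTypeIAncientMild_of_class hrate hcont hmild hdiv)
  have hreg : IsClassicalNSSolutionOnRegion W 1 0 v q := hq.onRegion.mono_of_isOpen hWs hW
  have hanV : AnalyticOnNhd ℝ (uncurry v) (Iio (0 : ℝ) ×ˢ univ) :=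
    analyticOnNhd_uncurry hcont (bdd_of_hasTypeITimeDecay hrate) hmild
  have han : AnalyticOnNhd ℝ (uncurry v) W := fun z hz => hanV z (hWs hz)
  have hpolW : ∀ z ∈ W, ⟪curl (v z.1) z.2, EuclideanSpace.single 2 1⟫_ℝ = 0 := fun z hz =>
    hpol z.1 (Set.mem_prod.1 (hWs hz)).1 z.2
  have hneg : ∀ z ∈ W, z.1 < 0 := fun z hz => (Set.mem_prod.1 (hWs hz)).1
  have hfrW : ∀ z ∈ W,
      fderiv ℝ (v z.1) z.2 (EuclideanSpace.single 2 1) 0 * fderiv ℝ (v z.1) z.2 (EuclideanSpace.single 1 1) 2 =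
        fderiv ℝ (v z.1) z.2 (EuclideanSpace.single 2 1) 1 * fderiv ℝ (v z.1) z.2 (EuclideanSpace.single 0 1) 2 :=
    fun z hz => frozen_coord hrate hcont hmild hdiv hpol (hneg z hz) z.2
  -- ## the ratio `Λ` and its joint analyticity on the window
  set Λv : ℝ → EuclideanSpace ℝ (Fin 3) → ℝ := fun t y =>
    (fderiv ℝ (v t) y (EuclideanSpace.single 2 1) 0 * fderiv ℝ (v t) y (EuclideanSpace.single 0 1) 2 +
        fderiv ℝ (v t) y (EuclideanSpace.single 2 1) 1 * fderiv ℝ (v t) y (EuclideanSpace.single 1 1) 2) /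
      (fderiv ℝ (v t) y (EuclideanSpace.single 0 1) 2 ^ 2 + fderiv ℝ (v t) y (EuclideanSpace.single 1 1) 2 ^ 2) with hΛv
  have hent : ∀ j i : Fin 3, ∀ z ∈ W,
      AnalyticAt ℝ (uncurry fun s y => fderiv ℝ (v s) y (EuclideanSpace.single j 1) i) z :=
    fun j i z hz => analyticOnNhd_uncurry_fderiv_entry hrate hcont hmild j i z (hWs hz)
  have hΛan : ∀ z ∈ W, AnalyticAt ℝ (uncurry Λv) z := by
    intro z hz
    have hden : (uncurry fun s y => fderiv ℝ (v s) y (EuclideanSpace.single 0 1) 2 ^ 2 +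
        fderiv ℝ (v s) y (EuclideanSpace.single 1 1) 2 ^ 2) z ≠ 0 := by
      rcases (hnd z hz).2.1 with h | h
      · have h' : 0 < fderiv ℝ (v z.1) z.2 (EuclideanSpace.single 0 1) 2 ^ 2 := by positivity
        have := sq_nonneg (fderiv ℝ (v z.1) z.2 (EuclideanSpace.single 1 1) 2)
        exact ne_of_gt (by simp only [uncurry]; linarith)
      · have h' : 0 < fderiv ℝ (v z.1) z.2 (EuclideanSpace.single 1 1) 2 ^ 2 := by positivity
        have := sq_nonneg (fderiv ℝ (v z.1) z.2 (EuclideanSpace.single 0 1) 2)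
        exact ne_of_gt (by simp only [uncurry]; linarith)
    have hnum : AnalyticAt ℝ (uncurry fun s y =>
        fderiv ℝ (v s) y (EuclideanSpace.single 2 1) 0 * fderiv ℝ (v s) y (EuclideanSpace.single 0 1) 2 +
          fderiv ℝ (v s) y (EuclideanSpace.single 2 1) 1 * fderiv ℝ (v s) y (EuclideanSpace.single 1 1) 2) z :=
      ((hent 2 0 z hz).mul (hent 0 2 z hz)).add ((hent 2 1 z hz).mul (hent 1 2 z hz))
    have hden' : AnalyticAt ℝ (uncurry fun s y => fderiv ℝ (v s) y (EuclideanSpace.single 0 1) 2 ^ 2 +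
        fderiv ℝ (v s) y (EuclideanSpace.single 1 1) 2 ^ 2) z :=
      ((hent 0 2 z hz).pow 2).add ((hent 1 2 z hz).pow 2)
    exact hnum.div hden' hden
  -- the horizontal slope-gradient fields, jointly continuous on the window
  have hG : ∀ b : Fin 3, ∀ z ∈ W,
      ContinuousAt (uncurry fun t y => fderiv ℝ (Λv t) y (EuclideanSpace.single b 1)) z :=
    fun b z hz => (analyticAt_uncurry_fderiv_slice_apply (hΛan z hz) (EuclideanSpace.single b 1)).continuousAt
  by_cases hA : ∃ p₀ ∈ W, fderiv ℝ (Λv p₀.1) p₀.2 (EuclideanSpace.single 0 1) ≠ 0 ∨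
      fderiv ℝ (Λv p₀.1) p₀.2 (EuclideanSpace.single 1 1) ≠ 0
  · -- ## Case A: the open sub-window `{∇ₕΛ ≠ 0}` is nonempty — `hopen` applies to it
    obtain ⟨p₀, hp₀, hp₀'⟩ := hA
    set U : Set (ℝ × EuclideanSpace ℝ (Fin 3)) :=
      {z | z ∈ W ∧ (fderiv ℝ (Λv z.1) z.2 (EuclideanSpace.single 0 1) ≠ 0 ∨
        fderiv ℝ (Λv z.1) z.2 (EuclideanSpace.single 1 1) ≠ 0)} with hU
    have hUW : U ⊆ W := fun z hz => hz.1
    have hUo : IsOpen U := by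
      rw [isOpen_iff_mem_nhds]
      rintro z ⟨hzW, hz⟩
      have hWn : W ∈ 𝓝 z := hW.mem_nhds hzW
      rcases hz with h | h
      · have h0 := (hG 0 z hzW).eventually_ne h
        filter_upwards [hWn, h0] with z' hz'W hz'
        exact ⟨hz'W, Or.inl hz'⟩
      · have h1 := (hG 1 z hzW).eventually_ne h
        filter_upwards [hWn, h1] with z' hz'W hz'
        exact ⟨hz'W, Or.inr hz'⟩
    have hp₀U : p₀ ∈ U := ⟨hp₀, hp₀'⟩
    exact (hopen v q U hUo ⟨p₀, hp₀U⟩ (hreg.mono_of_isOpen hUW hUo) (fun z hz => han z (hUW hz))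
      (fun p hp => hpolW p (hUW hp)) (fun p hp => hfrW p (hUW hp)) (fun p hp => hnd p (hUW hp))
      (fun p hp => htw p (hUW hp)) (fun p hp => hhyp p (hUW hp)) (fun p hp => hp.2)).elim
  · -- ## Case B: `∇ₕΛ ≡ 0` on the window — a ball of the window is time–height, contradicting thickness
    push Not at hA
    obtain ⟨z₀, hz₀⟩ := hWne
    obtain ⟨r, hr, hball⟩ := Metric.isOpen_iff.1 hW z₀ hz₀
    set m : ℝ → ℝ → ℝ := fun t z => Λv t (z₀.2 + (z - z₀.2 2) • EuclideanSpace.single 2 (1 : ℝ)) with hm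
    obtain ⟨p, hp, b, hb, hne⟩ := hthick m (ball z₀ r) hball isOpen_ball ⟨z₀, mem_ball_self hr⟩
    intro _hsing
    apply hne
    have hpW : p ∈ W := hball hp
    -- `∂₂v_b = Λ ∂_b v₂` at `p`
    have hratio := eq_ratio_mul_of_frozen (hfrW p hpW) (hnd p hpW).2.1
    -- `Λ` is horizontally constant on the `p.1`-section of the ball
    have hsec : ∀ y ∈ {y : EuclideanSpace ℝ (Fin 3) | (p.1, y) ∈ ball z₀ r}, (p.1, y) ∈ W := fun y hy => hball hy
    have hconst : Λv p.1 p.2 = Λv p.1 (z₀.2 + (p.2 2 - z₀.2 2) • EuclideanSpace.single 2 (1 : ℝ)) :=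
      eq_of_horizontal_fderiv_eq_zero (convex_section_ball z₀ r p.1)
        (fun y hy => (analyticAt_slice (hΛan _ (hsec y hy))).differentiableAt)
        (fun y hy => (hA _ (hsec y hy)).1) (fun y hy => (hA _ (hsec y hy)).2) hp (mem_ball_of_sameHeight hp)
        (by simp)
    have hmval : m p.1 (p.2 2) = Λv p.1 p.2 := hconst.symm
    rw [hmval]
    have hΛp : Λv p.1 p.2 =
        (fderiv ℝ (v p.1) p.2 (EuclideanSpace.single 2 1) 0 * fderiv ℝ (v p.1) p.2 (EuclideanSpace.single 0 1) 2 +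
            fderiv ℝ (v p.1) p.2 (EuclideanSpace.single 2 1) 1 * fderiv ℝ (v p.1) p.2 (EuclideanSpace.single 1 1) 2) /
          (fderiv ℝ (v p.1) p.2 (EuclideanSpace.single 0 1) 2 ^ 2 + fderiv ℝ (v p.1) p.2 (EuclideanSpace.single 1 1) 2 ^ 2) := by
      rw [hΛv]
    rw [hΛp]
    fin_cases b
    · exact hratio.1
    · exact hratio.2
    · exact absurd rfl hb

end Summit.NavierStokesRegularity.NavierStokesRegularity.Theorems.PoloidalWindowDoorPoloidalWindowRigidityHyperbolicThickOfLocalOpen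

end
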